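import Summits.CriticalPhenomena.PercolationContinuityZ3.Theses.PercMonotoneFactors

/-!
# Route `PercMonotoneFactors`, item `Assembly` (stmt-CriticalPhenomena-4494)

`Assembly` says `ClassNoJump → PercolationContinuityZ3` (`θ_{ℤ³}(p_c) = 0`).

Proof (pure logic plus two tree facts): Bernoulli bond percolation on `ℤ³` is the member `F = id`
(range `R = 0`) of the class of admissible block rules — `id` is measurable and monotone, fixes `∅`
and the edge set, is edge-set supported, commutes with every `Sym2.map φ`, and is local of range `0`
(an edge agrees in two configurations that agree on every pair meeting it, in particular on itself).
Instantiating `ClassNoJump` there, `Measure.map id μ = μ` turns `θ_id` into `θ`, and at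
`t = p_c(ℤ³)` (as a point `criticalProbI 3` of `[0,1]`) the hypothesis "`θ(s) = 0` for all `s < t`"
is `Literature.Probability.Percolation.theta_eq_zero_of_lt_criticalProb_holds` (Grimmett 1999,
(1.11)). The conclusion is literally `PercolationContinuity 3`.

No new definitions; no named-fact hypotheses (unconditional).
-/

namespace Summit.CriticalPhenomena.PercolationContinuityZ3.Theorems

open MeasureTheory Literature.Probability.Percolation Literature.Probability.LatticeModels

/-- **Item `stmt-CriticalPhenomena-4494` (`PercMonotoneFactors.Assembly`), proved.**
`ClassNoJump → PercolationContinuityZ3`: specialise the class-wide no-jump statement to the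
identity rule `F = id` of range `0` (Bernoulli bond percolation itself), rewrite `Measure.map id`,
and feed it `θ(s) = 0` for `s < p_c` (`theta_eq_zero_of_lt_criticalProb_holds`); the output is
`θ(p_c(ℤ³)) = 0`. [folklore] -/
theorem percMonotoneFactorsAssembly_proof :
    Summit.CriticalPhenomena.PercolationContinuityZ3.Theses.PercMonotoneFactors.Assembly := by
  unfold Summit.CriticalPhenomena.PercolationContinuityZ3.Theses.PercMonotoneFactors.Assembly
    Summit.CriticalPhenomena.PercolationContinuityZ3.Theses.PercMonotoneFactors.ClassNoJump
  intro hClassNoJump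
  show theta (zdGraph 3) (0 : Site 3) (criticalProbI 3) = 0
  -- specialise the class statement to `F = id`, `R = 0`
  have key := hClassNoJump 0 id measurable_id monotone_id rfl rfl (fun _ hω => hω)
    (fun _ _ => rfl)
    (fun _ _ e hloc => hloc e ⟨e.out.1, Sym2.out_fst_mem e, e.out.1, Sym2.out_fst_mem e,
      fun i => by simp⟩)
    (criticalProbI 3)
    (fun s hs => by
      rw [Measure.map_id]
      exact theta_eq_zero_of_lt_criticalProb_holds (zdGraph 3) 0 s hs)
  rw [Measure.map_id] at key
  exact key

end Summit.CriticalPhenomena.PercolationContinuityZ3.Theorems
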